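import Summits.Ventures.PercRepro.S1CFRelCover

/-!
# PercRepro — PARALLEL SUBSTITUTION: REPLACING A POINT OF A CIRCUIT BY A PARALLEL ONE, AND THE LIFTING OF CIRCUIT COUNTS (p1, gen 37)

The lifting tool of the ν = 4 caps: for a dependent pair `{a, a'}` (two parallel non-loops) the circuits of size `k ≥ 3`
inside a set `Y ∋ a, a'` number at most TWICE the circuits of size `k` inside `Y ∖ {a'}`.
* **`closure_insert_eq_closure_insert_of_parallel`** — `cl (insert a A) = cl (insert a' A)` for parallel `a, a'`;
* **`indep_insert_of_indep_insert_of_parallel`** — independence is preserved by the substitution;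
* **`isCircuit_insert_sdiff_of_parallel`** — `C` a circuit, `a' ∈ C`, `a ∉ C` ⇒ `insert a (C ∖ {a'})` is a circuit;
* **`ncard_isCircuit_le_two_mul_sdiff`** — `#{circuits of size k ≥ 3 inside Y} ≤ 2 · #{circuits of size k inside Y ∖ {a'}}`
  (the circuits avoiding `a'` are inside `Y ∖ {a'}`; those through `a'` inject by the substitution).
Nothing about any cell is claimed. Axioms: standard.
-/

open scoped Matroid

namespace PercRepro

namespace S1CF

open Set

variable {α : Type}

/-- For parallel non-loops `a, a'` (`a ∈ cl {a'}` and `a' ∈ cl {a}`), `cl (insert a A) = cl (insert a' A)`. -/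
theorem closure_insert_eq_closure_insert_of_parallel (M : Matroid α) {a a' : α} (ha : a ∈ M.closure {a'})
    (ha' : a' ∈ M.closure {a}) (A : Set α) (hA : A ⊆ M.E) :
    M.closure (insert a A) = M.closure (insert a' A) := by
  have haE : a ∈ M.E := M.closure_subset_ground _ ha
  have ha'E : a' ∈ M.E := M.closure_subset_ground _ ha'
  have key : ∀ b b' : α, b ∈ M.E → b' ∈ M.E → b ∈ M.closure {b'} →
      M.closure (insert b A) ⊆ M.closure (insert b' A) := by
    intro b b' hbE hb'E hb
    apply M.closure_subset_closure_of_subset_closure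
    apply Set.insert_subset
    · exact M.closure_subset_closure (Set.singleton_subset_iff.2 (Set.mem_insert b' A)) hb
    · exact (Set.subset_insert b' A).trans (M.subset_closure _ (Set.insert_subset hb'E hA))
  exact le_antisymm (key a a' haE ha'E ha) (key a' a ha'E haE ha')

/-- Independence is preserved by replacing `a'` with a parallel `a` (`a ∉ A`). -/
theorem indep_insert_of_indep_insert_of_parallel (M : Matroid α) [M.Finite] {a a' : α} (ha : a ∈ M.closure {a'})
    (ha' : a' ∈ M.closure {a}) {A : Set α} (hA : A ⊆ M.E) (haA : a ∉ A) (ha'A : a' ∉ A)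
    (hI : M.Indep (insert a' A)) : M.Indep (insert a A) := by
  have haE : a ∈ M.E := M.closure_subset_ground _ ha
  have hAfin : A.Finite := M.ground_finite.subset hA
  rw [Matroid.indep_iff_eRk_eq_encard_of_finite (hAfin.insert a)]
  have h1 : M.eRk (insert a A) = M.eRk (insert a' A) := by
    rw [← M.eRk_closure_eq, closure_insert_eq_closure_insert_of_parallel M ha ha' A hA, M.eRk_closure_eq]
  rw [h1, hI.eRk_eq_encard, Set.encard_insert_of_notMem haA, Set.encard_insert_of_notMem ha'A]

/-- **Parallel substitution in a circuit**: `C` a circuit with `a' ∈ C`, `a ∉ C`, `a` parallel to `a'`, gives the circuit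
`insert a (C ∖ {a'})`. -/
theorem isCircuit_insert_sdiff_of_parallel (M : Matroid α) [M.Finite] {a a' : α} (ha : a ∈ M.closure {a'})
    (ha' : a' ∈ M.closure {a}) {C : Set α} (hC : M.IsCircuit C) (ha'C : a' ∈ C) (haC : a ∉ C) :
    M.IsCircuit (insert a (C \ {a'})) := by
  have hCE : C ⊆ M.E := hC.subset_ground
  have haE : a ∈ M.E := M.closure_subset_ground _ ha
  have hCfin : C.Finite := M.ground_finite.subset hCE
  have hC'E : C \ {a'} ⊆ M.E := sdiff_subset.trans hCE
  have hC'ind : M.Indep (C \ {a'}) := hC.ssubset_indep (Set.sdiff_singleton_ssubset.2 ha'C)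
  have haC' : a ∉ C \ {a'} := fun h => haC h.1
  rw [Matroid.isCircuit_iff_dep_forall_sdiff_singleton_indep]
  constructor
  · -- dependent: `a ∈ cl (C ∖ {a'})`
    rw [hC'ind.insert_dep_iff]
    refine ⟨?_, haC'⟩
    have h1 : a' ∈ M.closure (C \ {a'}) := hC.mem_closure_sdiff_singleton_of_mem ha'C
    exact M.closure_subset_closure_of_subset_closure (Set.singleton_subset_iff.2 h1) ha
  · intro e he
    rcases he with rfl | heC'
    · -- removing `a`
      -- careful: here `e = a`, and the set is `insert a (C ∖ {a'}) ∖ {a} = C ∖ {a'}`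
      have e1 : insert e (C \ {a'}) \ {e} = C \ {a'} := by
        ext w
        simp only [Set.mem_sdiff, Set.mem_insert_iff, Set.mem_singleton_iff]
        constructor
        · rintro ⟨h | h, hw⟩
          · exact absurd h hw
          · exact h
        · intro h
          refine ⟨Or.inr h, ?_⟩
          rintro rfl
          exact haC h.1
      rw [e1]; exact hC'ind
    · -- removing `e ∈ C ∖ {a'}`: substitute `a` for `a'` in the independent set `C ∖ {e}`
      have heC : e ∈ C := heC'.1
      have hea' : e ≠ a' := heC'.2
      have hea : e ≠ a := fun h => haC (h ▸ heC)
      have hind : M.Indep (C \ {e}) := hC.ssubset_indep (Set.sdiff_singleton_ssubset.2 heC)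
      set A := (C \ {e}) \ {a'} with hAdef
      have hAE : A ⊆ M.E := (sdiff_subset.trans sdiff_subset).trans hCE
      have haA : a ∉ A := fun h => haC h.1.1
      have ha'A : a' ∉ A := fun h => h.2 rfl
      have hCe : insert a' A = C \ {e} := by
        have ha'Ce : a' ∈ C \ {e} := ⟨ha'C, fun h => hea' (Set.mem_singleton_iff.1 h).symm⟩
        rw [hAdef, Set.insert_sdiff_singleton, Set.insert_eq_of_mem ha'Ce]
      have hI : M.Indep (insert a' A) := by rw [hCe]; exact hind
      have hI' := indep_insert_of_indep_insert_of_parallel M ha ha' hAE haA ha'A hI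
      have e2 : insert a (C \ {a'}) \ {e} = insert a A := by
        ext w
        simp only [hAdef, Set.mem_sdiff, Set.mem_insert_iff, Set.mem_singleton_iff]
        constructor
        · rintro ⟨h | ⟨hwC, hwa'⟩, hwe⟩
          · exact Or.inl h
          · exact Or.inr ⟨⟨hwC, hwe⟩, hwa'⟩
        · rintro (rfl | ⟨⟨hwC, hwe⟩, hwa'⟩)
          · exact ⟨Or.inl rfl, hea.symm⟩
          · exact ⟨Or.inr ⟨hwC, hwa'⟩, hwe⟩
      rw [e2]; exact hI'

/-- **The lifting**: for a dependent pair `{a, a'}` of non-loops (`a ≠ a'`) and `k ≥ 3`, the circuits of size `k` inside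
`Y` number at most twice the circuits of size `k` inside `Y ∖ {a'}`. -/
theorem ncard_isCircuit_le_two_mul_sdiff (M : Matroid α) [M.Finite] (hL : ∀ e ∈ M.E, ¬ M.IsLoop e)
    {a a' : α} (haE : a ∈ M.E) (ha'E : a' ∈ M.E) (haa' : a ≠ a') (hdep : M.Dep {a, a'}) {Y : Set α} (hY : Y ⊆ M.E)
    (haY : a ∈ Y) {k : ℕ} (hk : 3 ≤ k) :
    {C : Set α | C ⊆ Y ∧ M.IsCircuit C ∧ C.ncard = k}.ncard ≤
      2 * {C : Set α | C ⊆ Y \ {a'} ∧ M.IsCircuit C ∧ C.ncard = k}.ncard := by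
  classical
  have hEfin := M.ground_finite
  have ha : a ∈ M.closure {a'} := mem_closure_singleton_of_dep_pair M ha'E (hL a' ha'E) (by rwa [Set.pair_comm])
  have ha' : a' ∈ M.closure {a} := mem_closure_singleton_of_dep_pair M haE (hL a haE) hdep
  set 𝒞 := {C : Set α | C ⊆ Y \ {a'} ∧ M.IsCircuit C ∧ C.ncard = k} with h𝒞
  have h𝒞fin : 𝒞.Finite := hEfin.finite_subsets.subset (fun C hC => (hC.1.trans sdiff_subset).trans hY)
  -- the circuits avoiding `a'` and those through `a'`
  have hsplit : {C : Set α | C ⊆ Y ∧ M.IsCircuit C ∧ C.ncard = k} ⊆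
      𝒞 ∪ {C : Set α | C ⊆ Y ∧ M.IsCircuit C ∧ C.ncard = k ∧ a' ∈ C} := by
    intro C hC
    by_cases ha'C : a' ∈ C
    · exact Or.inr ⟨hC.1, hC.2.1, hC.2.2, ha'C⟩
    · exact Or.inl ⟨Set.subset_sdiff_singleton hC.1 ha'C, hC.2.1, hC.2.2⟩
  -- the circuits through `a'` inject into `𝒞` by the substitution
  have hmap : ∀ C ∈ {C : Set α | C ⊆ Y ∧ M.IsCircuit C ∧ C.ncard = k ∧ a' ∈ C},
      (fun C : Set α => insert a (C \ {a'})) C ∈ 𝒞 := by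
    intro C hC
    obtain ⟨hCY, hCc, hCk, ha'C⟩ := hC
    have hCfin : C.Finite := hEfin.subset (hCY.trans hY)
    have haC : a ∉ C := by
      intro haC
      exact not_dep_pair_of_isCircuit M hCc (by
        intro w hw; rcases hw with rfl | rfl; exacts [haC, ha'C]) (Set.ncard_pair haa') (by omega) hdep
    refine ⟨?_, isCircuit_insert_sdiff_of_parallel M ha ha' hCc ha'C haC, ?_⟩
    · apply Set.insert_subset (show a ∈ Y \ {a'} from ⟨haY, haa'⟩)
      exact Set.sdiff_subset_sdiff_left hCY
    · rw [Set.ncard_insert_of_notMem (fun h => haC h.1) (hCfin.subset sdiff_subset),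
        Set.ncard_sdiff_singleton_of_mem ha'C, hCk]
      omega
  have hinj : Set.InjOn (fun C : Set α => insert a (C \ {a'}))
      {C : Set α | C ⊆ Y ∧ M.IsCircuit C ∧ C.ncard = k ∧ a' ∈ C} := by
    intro C hC C' hC' h
    simp only at h
    have hCk : C.ncard = k := hC.2.2.1
    have hC'k : C'.ncard = k := hC'.2.2.1
    have haC : a ∉ C := by
      intro haC
      exact not_dep_pair_of_isCircuit M hC.2.1 (by
        intro w hw; rcases hw with rfl | rfl; exacts [haC, hC.2.2.2]) (Set.ncard_pair haa') (by omega) hdep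
    have haC' : a ∉ C' := by
      intro haC'
      exact not_dep_pair_of_isCircuit M hC'.2.1 (by
        intro w hw; rcases hw with rfl | rfl; exacts [haC', hC'.2.2.2]) (Set.ncard_pair haa') (by omega) hdep
    -- recover `C` as `insert a' ((insert a (C ∖ {a'})) ∖ {a})`
    have key : ∀ D : Set α, a ∉ D → a' ∈ D → insert a' (insert a (D \ {a'}) \ {a}) = D := by
      intro D haD ha'D
      ext w
      simp only [Set.mem_insert_iff, Set.mem_sdiff, Set.mem_singleton_iff]
      constructor
      · intro hw
        rcases hw with hwa' | ⟨hw, hwa⟩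
        · rw [hwa']; exact ha'D
        · rcases hw with hwa'' | ⟨hwD, -⟩
          · exact absurd hwa'' hwa
          · exact hwD
      · intro hwD
        by_cases hwa' : w = a'
        · exact Or.inl hwa'
        · exact Or.inr ⟨Or.inr ⟨hwD, hwa'⟩, fun hwa => haD (hwa ▸ hwD)⟩
    rw [← key C haC hC.2.2.2, ← key C' haC' hC'.2.2.2, h]
  calc {C : Set α | C ⊆ Y ∧ M.IsCircuit C ∧ C.ncard = k}.ncard
      ≤ (𝒞 ∪ {C : Set α | C ⊆ Y ∧ M.IsCircuit C ∧ C.ncard = k ∧ a' ∈ C}).ncard :=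
        Set.ncard_le_ncard hsplit (h𝒞fin.union (hEfin.finite_subsets.subset (fun C hC => hC.1.trans hY)))
    _ ≤ 𝒞.ncard + {C : Set α | C ⊆ Y ∧ M.IsCircuit C ∧ C.ncard = k ∧ a' ∈ C}.ncard := Set.ncard_union_le _ _
    _ ≤ 𝒞.ncard + 𝒞.ncard :=
        Nat.add_le_add_left (Set.ncard_le_ncard_of_injOn _ hmap hinj h𝒞fin) _
    _ = 2 * 𝒞.ncard := by ring

end S1CF

end PercRepro
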